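import Literature.MathematicalPhysics.QuantumLattice.Su2Multiplet
import Literature.MathematicalPhysics.QuantumLattice.SectorGroundState
import Literature.MathematicalPhysics.QuantumLattice.GroundStateSectorGapModeBound
import Literature.MathematicalPhysics.QuantumLattice.SpinChainsLiebMattisProofs

/-!
# SU(2) weight-zero reduction: `X ⪰ s` on `S^z_tot = 0` ⟹ `X - s·1 ⪰ 0` ([D] of the cluster pair-cut road)

HONEST FRAMING: ladder R1–R4 with certified numbers; no claim on H/H₀.

[D] SU(2) WEIGHT-ZERO REDUCTION LEMMA (desk LEAD g32 l.5143 (2)(A); author r2 g43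
`planner-pub-hubbard-r2-g43-0`, 2026-08-27; reader r2-eng-1 g12).  Staged in the pub-hubbard cell;
filed only on a desk GO by a FILER seat.  Infrastructure: it certifies no cell by itself.

Purpose (cluster pair-cut road, spec memo `CLUSTER-ROW-SPEC-g43.md` v2 §6 Q1): the per-cut block
certificates `B_b - s·G_b ⪰ 0` are produced on the `M = 0` (`S^z_tot = 0`) sector only; this file
supplies, ONCE and abstractly, the step `X ⪰ s on the weight-zero sector ⟹ X - s·1 ⪰ 0 everywhere`
for an `SU(2)`-invariant Hermitian `X` on a system with integer weights (an even number of
spin-½ sites).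

Mathematics (Tasaki (2020) §2.4; Lieb–Mattis (1962)): let `(S⁺, S⁻, S^z)` be an `su(2)` triple and
`X` Hermitian with `[X, S^±] = 0` (hence `[X, S^z] = 0`).  A joint eigenvector `ψ` of `(X, S^z)` at
the bottom of the spectrum of `X` exists (`Matrix.exists_unit_joint_eigenvector_minEnergyOn`); its
weight `q` is an integer by hypothesis.  If `q = m ≥ 0` then `(S⁻)^m ψ ≠ 0`
(`IsSu2Triple.eq_zero_of_M_pow_eq_zero`: `‖S⁻v‖² = ‖S⁺v‖² + 2m‖v‖²`), has weight `0`
(`IsSu2Triple.weight_M_pow`) and the same `X`-eigenvalue; if `q = -m < 0` the same holds with the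
mirror triple `(S⁻, S⁺, -S^z)` (`IsSu2Triple.mirror`).  Hence `λ_min(X) = λ_min(X|_{S^z = 0}) ≥ s`.

Main results:
* `rayleigh_ge_of_weightZero`      — abstract: `s‖w‖² ≤ Re⟨w, X w⟩` for every `w`;
* `posSemidef_sub_smul_of_weightZero` — abstract: `(X - s·1).PosSemidef`;
* `posSemidef_sub_smul_of_weightZero_spinHalf` — `n` spin-½ sites, `n` even, `X : Op Λ 2`
  commuting with the three total-spin components.
-/

namespace Summit.HubbardSuperconductivity.HubbardLadder.ClusterCut

open Matrix Complex
open scoped ComplexOrder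
open Literature.MathematicalPhysics.QuantumLattice

section Abstract

variable {ι : Type*} [Fintype ι] [DecidableEq ι] {P M Z X : Matrix ι ι ℂ}

/-- Descent to weight zero: a nonzero `X`-eigenvector of natural weight `m` is mapped by `(S⁻)^m`
to a NONZERO weight-zero `X`-eigenvector with the same eigenvalue (`[X, S⁻] = 0`).
Tasaki (2020) §2.4. [folklore] -/
theorem exists_weightZero_eigenvector_of_natWeight (hT : IsSu2Triple P M Z) (hXM : X * M = M * X)
    {ψ : ι → ℂ} {E : ℂ} {m : ℕ} (hψ0 : ψ ≠ 0) (hXψ : X *ᵥ ψ = E • ψ)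
    (hZψ : Z *ᵥ ψ = (m : ℂ) • ψ) :
    ∃ φ : ι → ℂ, φ ≠ 0 ∧ Z *ᵥ φ = 0 ∧ X *ᵥ φ = E • φ := by
  refine ⟨M ^ m *ᵥ ψ, ?_, ?_, ?_⟩
  · intro h
    exact hψ0 (hT.eq_zero_of_M_pow_eq_zero m le_rfl hZψ h)
  · have h := hT.weight_M_pow hZψ m
    rwa [sub_self, zero_smul] at h
  · have hc : X * M ^ m = M ^ m * X := (Commute.pow_right (show Commute X M from hXM) m).eq
    rw [mulVec_mulVec, hc, ← mulVec_mulVec, hXψ, mulVec_smul]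

omit [DecidableEq ι] in
/-- `[X, S⁺] = [X, S⁻] = 0 ⟹ [X, S^z] = 0` (since `2 S^z = [S⁺, S⁻]`). [folklore] -/
theorem commute_Z_of_commute_PM (hT : IsSu2Triple P M Z) (hXP : X * P = P * X)
    (hXM : X * M = M * X) : Z * X = X * Z := by
  have h1 : P * M * X = X * (P * M) := by
    rw [Matrix.mul_assoc, ← hXM, ← Matrix.mul_assoc, ← hXP, Matrix.mul_assoc]
  have h2 : M * P * X = X * (M * P) := by
    rw [Matrix.mul_assoc, ← hXP, ← Matrix.mul_assoc, ← hXM, Matrix.mul_assoc]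
  have h3 : ((2 : ℂ) • Z) * X = X * ((2 : ℂ) • Z) := by
    rw [← hT.comm_PM, Matrix.sub_mul, Matrix.mul_sub, h1, h2]
  rw [Matrix.smul_mul, Matrix.mul_smul] at h3
  exact smul_right_injective (Matrix ι ι ℂ) (two_ne_zero) h3

/-- **Weight-zero reduction (variational form).** For an `su(2)` triple `(S⁺, S⁻, S^z)` with INTEGER
weights and a Hermitian `X` commuting with `S⁺` and `S⁻`: if `s‖v‖² ≤ Re⟨v, X v⟩` on the weight-zero
sector `S^z v = 0`, then `s‖w‖² ≤ Re⟨w, X w⟩` for every `w`. Tasaki (2020) §2.4;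
Lieb–Mattis, J. Math. Phys. 3 (1962) 749. [folklore] -/
theorem rayleigh_ge_of_weightZero (hT : IsSu2Triple P M Z) (hX : X.IsHermitian)
    (hXP : X * P = P * X) (hXM : X * M = M * X)
    (hZint : ∀ (v : ι → ℂ) (c : ℂ), v ≠ 0 → Z *ᵥ v = c • v → ∃ k : ℤ, c = k)
    {s : ℝ} (h0 : ∀ v : ι → ℂ, Z *ᵥ v = 0 → s * (star v ⬝ᵥ v).re ≤ (star v ⬝ᵥ X *ᵥ v).re)
    (w : ι → ℂ) : s * (star w ⬝ᵥ w).re ≤ (star w ⬝ᵥ X *ᵥ w).re := by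
  classical
  rcases isEmpty_or_nonempty ι with hι | hι
  · have hw : w = 0 := Subsingleton.elim _ _
    simp [hw]
  have hZX : Z * X = X * Z := commute_Z_of_commute_PM hT hXP hXM
  -- a joint eigenvector of `(X, Z)` at the bottom of the spectrum of `X`
  obtain ⟨ψ, -, hψ1, hXψ, q, hZψ⟩ := Matrix.exists_unit_joint_eigenvector_minEnergyOn hX ⊤
    (fun v _ => Submodule.mem_top) top_ne_bot hT.herm hZX (fun v _ => Submodule.mem_top)
  set E : ℝ := X.minEnergyOn ⊤ with hE
  have hψ0 : ψ ≠ 0 := by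
    rintro rfl
    rw [star_zero, zero_dotProduct] at hψ1
    exact zero_ne_one hψ1
  obtain ⟨k, hk⟩ := hZint ψ (q : ℂ) hψ0 hZψ
  -- descend to weight zero, from positive weight with `S⁻`, from negative weight with `S⁺`
  have hφ : ∃ φ : ι → ℂ, φ ≠ 0 ∧ Z *ᵥ φ = 0 ∧ X *ᵥ φ = ((E : ℝ) : ℂ) • φ := by
    obtain ⟨m, hm | hm⟩ := Int.eq_nat_or_neg k
    · have hZψ' : Z *ᵥ ψ = (m : ℂ) • ψ := by
        rw [hZψ, hk, hm, Int.cast_natCast]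
      exact exists_weightZero_eigenvector_of_natWeight hT hXM hψ0 hXψ hZψ'
    · have hZψ' : (-Z) *ᵥ ψ = (m : ℂ) • ψ := by
        rw [neg_mulVec, hZψ, hk, hm, Int.cast_neg, Int.cast_natCast, neg_smul, neg_neg]
      obtain ⟨φ, hφ0, hZφ, hXφ⟩ :=
        exists_weightZero_eigenvector_of_natWeight hT.mirror hXP hψ0 hXψ hZψ'
      refine ⟨φ, hφ0, ?_, hXφ⟩
      rwa [neg_mulVec, neg_eq_zero] at hZφ
  obtain ⟨φ, hφ0, hZφ, hXφ⟩ := hφ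
  -- hence `s ≤ E`
  have hpos : 0 < (star φ ⬝ᵥ φ).re := by
    have h := Matrix.dotProduct_star_self_pos_iff.mpr hφ0
    exact (Complex.pos_iff.mp h).1
  have hsE : s ≤ E := by
    have h := h0 φ hZφ
    rw [hXφ, dotProduct_smul, smul_eq_mul, Complex.re_ofReal_mul] at h
    exact le_of_mul_le_mul_right h hpos
  -- and `E‖w‖² ≤ Re⟨w, X w⟩` for every `w`
  have hEw : E * (star w ⬝ᵥ w).re ≤ (star w ⬝ᵥ X *ᵥ w).re :=
    minEnergyOn_mul_le_rayleigh_of_mem hX ⊤ (Submodule.mem_top (x := w))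
  have hw0 : 0 ≤ (star w ⬝ᵥ w).re := (Complex.nonneg_iff.mp (dotProduct_star_self_nonneg w)).1
  exact le_trans (mul_le_mul_of_nonneg_right hsE hw0) hEw

omit [DecidableEq ι] in
/-- A quadratic form of a Hermitian matrix is real. [folklore] -/
theorem im_rayleigh_eq_zero (hX : X.IsHermitian) (x : ι → ℂ) : (star x ⬝ᵥ (X *ᵥ x)).im = 0 := by
  have h : star (star x ⬝ᵥ (X *ᵥ x)) = star x ⬝ᵥ (X *ᵥ x) := by
    conv_lhs => rw [star_dotProduct, star_star, star_mulVec, ← dotProduct_mulVec, hX.eq]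
  exact Complex.conj_eq_iff_im.1 h

/-- **Weight-zero reduction (operator form).** Under the hypotheses of `rayleigh_ge_of_weightZero`,
`X - s·1` is positive semidefinite: `λ_min(X) = λ_min(X|_{S^z = 0}) ≥ s`. Tasaki (2020) §2.4;
Lieb–Mattis (1962). [folklore] -/
theorem posSemidef_sub_smul_of_weightZero (hT : IsSu2Triple P M Z) (hX : X.IsHermitian)
    (hXP : X * P = P * X) (hXM : X * M = M * X)
    (hZint : ∀ (v : ι → ℂ) (c : ℂ), v ≠ 0 → Z *ᵥ v = c • v → ∃ k : ℤ, c = k)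
    {s : ℝ} (h0 : ∀ v : ι → ℂ, Z *ᵥ v = 0 → s * (star v ⬝ᵥ v).re ≤ (star v ⬝ᵥ X *ᵥ v).re) :
    (X - (s : ℂ) • (1 : Matrix ι ι ℂ)).PosSemidef := by
  have hherm : (X - (s : ℂ) • (1 : Matrix ι ι ℂ)).IsHermitian := by
    refine hX.sub ?_
    rw [Matrix.IsHermitian, conjTranspose_smul, conjTranspose_one, Complex.star_def,
      Complex.conj_ofReal]
  refine Matrix.PosSemidef.of_dotProduct_mulVec_nonneg hherm fun x => ?_
  have hre := rayleigh_ge_of_weightZero hT hX hXP hXM hZint h0 x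
  have him := im_rayleigh_eq_zero hX x
  have him0 : (star x ⬝ᵥ x).im = 0 :=
    (Complex.nonneg_iff.mp (dotProduct_star_self_nonneg x)).2.symm
  rw [Matrix.sub_mulVec, Matrix.smul_mulVec, Matrix.one_mulVec, dotProduct_sub,
    dotProduct_smul, smul_eq_mul, Complex.nonneg_iff, Complex.sub_re, Complex.sub_im,
    Complex.re_ofReal_mul, Complex.im_ofReal_mul, him, him0, mul_zero, sub_zero]
  exact ⟨sub_nonneg.mpr hre, rfl⟩

end Abstract

/-! ### Spin-½ systems with an even number of sites -/

section SpinHalf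

variable {Λ : Type*} [Fintype Λ] [DecidableEq Λ]

/-- On an EVEN number of spin-½ sites every eigenvalue of `S^z_tot` is an integer
(`S^z_tot |σ⟩ = (|Λ|/2 - #↓(σ)) |σ⟩`). Tasaki (2020) §2.2, eq. (2.2.11). [folklore] -/
theorem totalSpin_two_weight_int (hΛ : Even (Fintype.card Λ)) (v : TensorIndex Λ 2 → ℂ) (c : ℂ)
    (hv : v ≠ 0) (hZ : (totalSpin 1 2 : Op Λ 2) *ᵥ v = c • v) : ∃ k : ℤ, c = k := by
  obtain ⟨σ, hσ⟩ : ∃ σ, v σ ≠ 0 := Function.ne_iff.mp hv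
  have h := congrFun hZ σ
  rw [totalSpin_two_mulVec_apply, Pi.smul_apply, smul_eq_mul] at h
  have hc : c = ((mag 1 σ : ℝ) : ℂ) := (mul_right_cancel₀ hσ h).symm
  obtain ⟨p, hp⟩ := hΛ
  refine ⟨(p : ℤ) - ((∑ x, (σ x).val : ℕ) : ℤ), ?_⟩
  rw [hc, mag_eq, hp]
  push_cast
  ring

/-- **Weight-zero reduction for `SU(2)`-invariant operators on an even number of spin-½ sites.**
If `X : Op Λ 2` is Hermitian, commutes with the three components of the total spin, and
`s‖v‖² ≤ Re⟨v, X v⟩` for every `v` in the sector `S^z_tot v = 0`, then `X - s·1 ⪰ 0` on the whole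
space.  This is the step `σ ≤ λ_min(X_C|_{M=0}) ⟹ X_C ⪰ σ·1` of the cluster pair-cut road
(the `M = 0` block certificates suffice). Tasaki (2020) §2.4; Lieb–Mattis (1962). [folklore] -/
theorem posSemidef_sub_smul_of_weightZero_spinHalf (hΛ : Even (Fintype.card Λ)) {X : Op Λ 2}
    (hX : X.IsHermitian) (hcomm : ∀ α : Fin 3, X * totalSpin 1 α = totalSpin 1 α * X) {s : ℝ}
    (h0 : ∀ v : TensorIndex Λ 2 → ℂ, (totalSpin 1 2 : Op Λ 2) *ᵥ v = 0 →
      s * (star v ⬝ᵥ v).re ≤ (star v ⬝ᵥ X *ᵥ v).re) :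
    (X - (s : ℂ) • (1 : Op Λ 2)).PosSemidef := by
  have hT := isSu2Triple_on 1 (Finset.univ : Finset Λ)
  rw [raiseOn_univ, lowerOn_univ, zOn_univ] at hT
  refine posSemidef_sub_smul_of_weightZero hT hX ?_ ?_ (totalSpin_two_weight_int hΛ) h0
  · rw [Matrix.mul_add, Matrix.add_mul, Matrix.mul_smul, Matrix.smul_mul, hcomm 0, hcomm 1]
  · rw [Matrix.mul_sub, Matrix.sub_mul, Matrix.mul_smul, Matrix.smul_mul, hcomm 0, hcomm 1]

/-- Variational form of `posSemidef_sub_smul_of_weightZero_spinHalf`: the weight-zero bound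
propagates to every vector. [folklore] -/
theorem rayleigh_ge_of_weightZero_spinHalf (hΛ : Even (Fintype.card Λ)) {X : Op Λ 2}
    (hX : X.IsHermitian) (hcomm : ∀ α : Fin 3, X * totalSpin 1 α = totalSpin 1 α * X) {s : ℝ}
    (h0 : ∀ v : TensorIndex Λ 2 → ℂ, (totalSpin 1 2 : Op Λ 2) *ᵥ v = 0 →
      s * (star v ⬝ᵥ v).re ≤ (star v ⬝ᵥ X *ᵥ v).re) (w : TensorIndex Λ 2 → ℂ) :
    s * (star w ⬝ᵥ w).re ≤ (star w ⬝ᵥ X *ᵥ w).re := by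
  have hT := isSu2Triple_on 1 (Finset.univ : Finset Λ)
  rw [raiseOn_univ, lowerOn_univ, zOn_univ] at hT
  refine rayleigh_ge_of_weightZero hT hX ?_ ?_ (totalSpin_two_weight_int hΛ) h0 w
  · rw [Matrix.mul_add, Matrix.add_mul, Matrix.mul_smul, Matrix.smul_mul, hcomm 0, hcomm 1]
  · rw [Matrix.mul_sub, Matrix.sub_mul, Matrix.mul_smul, Matrix.smul_mul, hcomm 0, hcomm 1]

end SpinHalf

end Summit.HubbardSuperconductivity.HubbardLadder.ClusterCut
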